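import Summits.AnomalousDissipation.AnomalousDissipation.Theses.PointSink
import Summits.AnomalousDissipation.AnomalousDissipation.Theorems.PointSinkConeDesingularisationStubDissipationPosOfFarField

/-!
# Negative knowledge for the crux `ConeDesingularisation` (stmt-AnomalousDissipation-19034, route PointSink):
# III. Load-bearing hypotheses of the transfer stubs of line `Sketch`

Certified copy of the `-- Targets` section of the cdisprove work file
`Cruxes/ConeDesingularisation/Disproof.lean` (refuter-cdisprove-stmt-AnomalousDissipation-19034-0, cycle 1).
Supports stmt-AnomalousDissipation-19034; nothing here asserts a Theses decl positively.

The lead's registered skeleton `Cruxes/ConeDesingularisation/Lines/Sketch.lean` reduces the crux to one open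
stub (`stub_core`) and four transfer stubs, all four now landed. This file certifies which hypotheses of the
two substantial transfer stubs carry load, by refuting the stub with the hypothesis dropped ("any proof must
use it"):

* `stub_dissipationPosOfFarField_false_without_nontrivial` — drop `0 < ∫_{1<‖x‖<λ} ‖V‖²` from stub 5:
  false at `V = 0`, `Q = 0` (every other hypothesis holds, `∫|∇0|² = 0`).
* `stub_dissipationPosOfFarField_false_without_matching` — drop the shell-matching clause from stub 5:
  false at `Q = 0` and the MODEL CONE `V x = ‖x‖^{-2/3} e₀` (measurable, DSS of degree `-2/3`, `‖V‖²`
  locally integrable off `0`, positive mass on the fundamental shell: the `model_*` lemmas — a reusable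
  non-trivial inhabitant of the far-field data of the crux).
* `stub_envelopeOfFarField_false_without_matching` — drop the shell-matching clause from stub 4: false at
  `V = 0`, `Q ≡ e₀` (`∫_{B_R} 1 = R³ |B_1| ≫ C R^{5/3}`).

The shell volume facts are REUSED from the landed stub file
`PointSinkConeDesingularisationStubDissipationPosOfFarField` (`coneDissip_*`).
-/

noncomputable section

-- `Summit.<Summit>.<Problem>`: single-conjunct summit, the duplicate namespace is mandated (CONVENTIONS §2).
set_option linter.dupNamespace false

open MeasureTheory Filter Topology Set
open Literature.Analysis.FunctionSpaces Literature.Analysis.FluidPDE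

namespace Summit.AnomalousDissipation.AnomalousDissipation.Theorems.ConeDesingularisation.Negative

open Summit.AnomalousDissipation.AnomalousDissipation.Theorems
  (coneDissip_volumeReal_shell_pos coneDissip_volume_shell_lt_top coneDissip_isOpen_shell
    coneDissip_integrableOn_shell)

/-! ## Stub 5 without the non-triviality of the far field -/

/-- **`0 < ∫_{shell 0}‖V‖²` is load-bearing in `stub_dissipationPosOfFarField`**: with that hypothesis
dropped the stub is false — `V = 0`, `Q = 0`, `λ = 2` satisfy every remaining hypothesis (the matching
clause trivially) while `∫ |∇Q|² = 0`. [folklore] -/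
theorem stub_dissipationPosOfFarField_false_without_nontrivial :
    ¬ ∀ (lam : ℝ) (V Q : EuclideanSpace ℝ (Fin 3) → EuclideanSpace ℝ (Fin 3)), 1 < lam →
      ContDiff ℝ 1 Q → AEStronglyMeasurable V volume →
      (∀ x : EuclideanSpace ℝ (Fin 3), x ≠ 0 → V (lam • x) = lam ^ (-(2 / 3 : ℝ)) • V x) →
      LocallyIntegrableOn (fun x => ‖V x‖ ^ 2) {x : EuclideanSpace ℝ (Fin 3) | x ≠ 0} volume →
      Integrable (fun x => frobeniusNormSq (fderiv ℝ Q x)) →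
      Tendsto (fun k : ℕ => (lam ^ k) ^ (-(5 / 3 : ℝ)) *
          ∫ x in {x : EuclideanSpace ℝ (Fin 3) | lam ^ k < ‖x‖ ∧ ‖x‖ < lam ^ (k + 1)}, ‖Q x - V x‖ ^ 2)
          atTop (𝓝 0) →
      0 < ∫ x, frobeniusNormSq (fderiv ℝ Q x) := by
  intro h
  have := h 2 (fun _ => 0) (fun _ => 0) (by norm_num) contDiff_const aestronglyMeasurable_const
    (fun x _ => by simp) (by simpa using locallyIntegrableOn_zero)
    (by simp [frobeniusNormSq_zero]) (by simp)
  simp [frobeniusNormSq_zero] at this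

/-! ## The model cone `V x = ‖x‖^{-2/3} e₀` -/

/-- The model field `x ↦ ‖x‖^{-2/3} e₀` is discretely (indeed continuously) self-similar of degree `-2/3`.
[folklore] -/
theorem model_dss {lam : ℝ} (hlam : 0 < lam) (x : EuclideanSpace ℝ (Fin 3)) :
    (‖lam • x‖ ^ (-(2 / 3 : ℝ))) • (EuclideanSpace.single 0 (1 : ℝ) : EuclideanSpace ℝ (Fin 3)) =
      lam ^ (-(2 / 3 : ℝ)) •
        ((‖x‖ ^ (-(2 / 3 : ℝ))) • (EuclideanSpace.single 0 (1 : ℝ) : EuclideanSpace ℝ (Fin 3))) := by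
  rw [norm_smul, Real.norm_eq_abs, abs_of_pos hlam, Real.mul_rpow hlam.le (norm_nonneg _), smul_smul]

/-- The model field is measurable. [folklore] -/
theorem model_measurable :
    Measurable fun x : EuclideanSpace ℝ (Fin 3) =>
      (‖x‖ ^ (-(2 / 3 : ℝ))) • (EuclideanSpace.single 0 (1 : ℝ) : EuclideanSpace ℝ (Fin 3)) :=
  (measurable_norm.pow_const _).smul_const _

/-- Squared norm of the model field: `‖V x‖² = (‖x‖^{-2/3})²`. [folklore] -/
theorem norm_model_sq (x : EuclideanSpace ℝ (Fin 3)) :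
    ‖(‖x‖ ^ (-(2 / 3 : ℝ))) • (EuclideanSpace.single 0 (1 : ℝ) : EuclideanSpace ℝ (Fin 3))‖ ^ 2 =
      (‖x‖ ^ (-(2 / 3 : ℝ))) ^ 2 := by
  have hn : ‖(EuclideanSpace.single 0 (1 : ℝ) : EuclideanSpace ℝ (Fin 3))‖ = 1 := by simp
  rw [norm_smul, hn, mul_one, Real.norm_eq_abs, sq_abs]

/-- `‖V‖²` of the model field is locally integrable off the origin (continuous there). [folklore] -/
theorem model_locallyIntegrableOn :
    LocallyIntegrableOn
      (fun x : EuclideanSpace ℝ (Fin 3) =>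
        ‖(‖x‖ ^ (-(2 / 3 : ℝ))) • (EuclideanSpace.single 0 (1 : ℝ) : EuclideanSpace ℝ (Fin 3))‖ ^ 2)
      {x : EuclideanSpace ℝ (Fin 3) | x ≠ 0} volume := by
  have h1 : ContinuousOn (fun x : EuclideanSpace ℝ (Fin 3) => ‖x‖ ^ (-(2 / 3 : ℝ)))
      {x : EuclideanSpace ℝ (Fin 3) | x ≠ 0} :=
    continuous_norm.continuousOn.rpow_const fun x hx => Or.inl (norm_ne_zero_iff.2 hx)
  have h2 : ContinuousOn (fun x : EuclideanSpace ℝ (Fin 3) =>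
      (‖x‖ ^ (-(2 / 3 : ℝ))) • (EuclideanSpace.single 0 (1 : ℝ) : EuclideanSpace ℝ (Fin 3)))
      {x : EuclideanSpace ℝ (Fin 3) | x ≠ 0} := h1.smul continuousOn_const
  exact ((h2.norm).pow 2).locallyIntegrableOn isOpen_ne.measurableSet

/-- The model field has positive mass on the fundamental shell `1 < ‖x‖ < 2`
(`‖V x‖² ≥ (2^{-2/3})²` there, and the shell has positive finite volume). [folklore] -/
theorem model_shell_mass_pos :
    0 < ∫ x in {x : EuclideanSpace ℝ (Fin 3) | 1 < ‖x‖ ∧ ‖x‖ < 2},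
      ‖(‖x‖ ^ (-(2 / 3 : ℝ))) • (EuclideanSpace.single 0 (1 : ℝ) : EuclideanSpace ℝ (Fin 3))‖ ^ 2 := by
  have hc : (0 : ℝ) < ((2 : ℝ) ^ (-(2 / 3 : ℝ))) ^ 2 := by positivity
  have hint := coneDissip_integrableOn_shell (lam := 2)
    (V := fun x : EuclideanSpace ℝ (Fin 3) =>
      (‖x‖ ^ (-(2 / 3 : ℝ))) • (EuclideanSpace.single 0 (1 : ℝ) : EuclideanSpace ℝ (Fin 3)))
    model_locallyIntegrableOn
  have hle : ∫ x in {x : EuclideanSpace ℝ (Fin 3) | 1 < ‖x‖ ∧ ‖x‖ < 2}, ((2 : ℝ) ^ (-(2 / 3 : ℝ))) ^ 2 ≤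
      ∫ x in {x : EuclideanSpace ℝ (Fin 3) | 1 < ‖x‖ ∧ ‖x‖ < 2},
        ‖(‖x‖ ^ (-(2 / 3 : ℝ))) • (EuclideanSpace.single 0 (1 : ℝ) : EuclideanSpace ℝ (Fin 3))‖ ^ 2 := by
    refine setIntegral_mono_on (integrableOn_const (coneDissip_volume_shell_lt_top 2).ne) hint
      (coneDissip_isOpen_shell 2).measurableSet fun x hx => ?_
    rw [norm_model_sq]
    have h1 : (2 : ℝ) ^ (-(2 / 3 : ℝ)) ≤ ‖x‖ ^ (-(2 / 3 : ℝ)) :=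
      Real.rpow_le_rpow_of_nonpos (by linarith [hx.1]) hx.2.le (by norm_num)
    exact pow_le_pow_left₀ (Real.rpow_nonneg (by norm_num) _) h1 2
  rw [setIntegral_const, smul_eq_mul] at hle
  have hpos : 0 < volume.real {x : EuclideanSpace ℝ (Fin 3) | 1 < ‖x‖ ∧ ‖x‖ < 2} * ((2 : ℝ) ^ (-(2 / 3 : ℝ))) ^ 2 :=
    mul_pos (coneDissip_volumeReal_shell_pos (by norm_num)) hc
  linarith

/-! ## Stub 5 without the shell-matching clause -/

/-- **The shell-matching clause is load-bearing in `stub_dissipationPosOfFarField`**: with it dropped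
the stub is false — `Q = 0` and the model cone `V x = ‖x‖^{-2/3} e₀` (`λ = 2`) satisfy every remaining
hypothesis, including `0 < ∫_{1<‖x‖<2}‖V‖²`, while `∫ |∇Q|² = 0`. [folklore] -/
theorem stub_dissipationPosOfFarField_false_without_matching :
    ¬ ∀ (lam : ℝ) (V Q : EuclideanSpace ℝ (Fin 3) → EuclideanSpace ℝ (Fin 3)), 1 < lam →
      ContDiff ℝ 1 Q → AEStronglyMeasurable V volume →
      (∀ x : EuclideanSpace ℝ (Fin 3), x ≠ 0 → V (lam • x) = lam ^ (-(2 / 3 : ℝ)) • V x) →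
      LocallyIntegrableOn (fun x => ‖V x‖ ^ 2) {x : EuclideanSpace ℝ (Fin 3) | x ≠ 0} volume →
      0 < ∫ x in {x : EuclideanSpace ℝ (Fin 3) | 1 < ‖x‖ ∧ ‖x‖ < lam}, ‖V x‖ ^ 2 →
      Integrable (fun x => frobeniusNormSq (fderiv ℝ Q x)) →
      0 < ∫ x, frobeniusNormSq (fderiv ℝ Q x) := by
  intro h
  have := h 2
    (fun x => (‖x‖ ^ (-(2 / 3 : ℝ))) • (EuclideanSpace.single 0 (1 : ℝ) : EuclideanSpace ℝ (Fin 3)))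
    (fun _ => 0) (by norm_num) contDiff_const model_measurable.aestronglyMeasurable
    (fun x _ => model_dss (by norm_num) x) model_locallyIntegrableOn model_shell_mass_pos
    (by simp [frobeniusNormSq_zero])
  simp [frobeniusNormSq_zero] at this

/-! ## Stub 4 without the shell-matching clause -/

/-- **The shell-matching clause is load-bearing in `stub_envelopeOfFarField`**: with it dropped the
stub is false — `V = 0` and the constant field `Q ≡ e₀` (`λ = 2`) satisfy every remaining hypothesis, but
`∫_{B_R} ‖Q‖² = R³ |B_1|` admits no bound `C R^{5/3}` (`R^{5/3} ≤ R²` for `R ≥ 1`, so `|B_1| R ≤ C`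
for all `R ≥ 1`, absurd). [folklore] -/
theorem stub_envelopeOfFarField_false_without_matching :
    ¬ ∀ (lam : ℝ) (V Q : EuclideanSpace ℝ (Fin 3) → EuclideanSpace ℝ (Fin 3)), 1 < lam →
      Continuous Q → AEStronglyMeasurable V volume →
      (∀ x : EuclideanSpace ℝ (Fin 3), x ≠ 0 → V (lam • x) = lam ^ (-(2 / 3 : ℝ)) • V x) →
      LocallyIntegrableOn (fun x => ‖V x‖ ^ 2) {x : EuclideanSpace ℝ (Fin 3) | x ≠ 0} volume →
      ∃ C : ℝ, ∀ R : ℝ, 1 ≤ R →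
        ∫ x in Metric.ball (0 : EuclideanSpace ℝ (Fin 3)) R, ‖Q x‖ ^ 2 ≤ C * R ^ (5 / 3 : ℝ) := by
  intro h
  obtain ⟨C, hC⟩ := h 2 (fun _ => 0)
    (fun _ => (EuclideanSpace.single 0 (1 : ℝ) : EuclideanSpace ℝ (Fin 3))) (by norm_num)
    continuous_const aestronglyMeasurable_const (fun x _ => by simp) (by simpa using locallyIntegrableOn_zero)
  -- volumes of balls: `|B_R| = R³ |B_1|`, `|B_1| > 0`
  set v₁ : ℝ := volume.real (Metric.ball (0 : EuclideanSpace ℝ (Fin 3)) 1) with hv₁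
  have hv₁pos : 0 < v₁ :=
    ENNReal.toReal_pos (Metric.measure_ball_pos volume (0 : EuclideanSpace ℝ (Fin 3)) one_pos).ne'
      (measure_ball_lt_top).ne
  have hball : ∀ R : ℝ, 0 < R →
      volume.real (Metric.ball (0 : EuclideanSpace ℝ (Fin 3)) R) = R ^ 3 * v₁ := by
    intro R hR
    simp only [hv₁, measureReal_def]
    rw [Measure.addHaar_ball_of_pos volume (0 : EuclideanSpace ℝ (Fin 3)) hR, ENNReal.toReal_mul,
      ENNReal.toReal_ofReal (pow_nonneg hR.le _), finrank_euclideanSpace_fin]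
  have key : ∀ R : ℝ, 1 ≤ R → R ^ 3 * v₁ ≤ C * R ^ (5 / 3 : ℝ) := by
    intro R hR
    have h1 := hC R hR
    have hn : ‖(EuclideanSpace.single 0 (1 : ℝ) : EuclideanSpace ℝ (Fin 3))‖ = 1 := by simp
    simp only [hn, one_pow] at h1
    rwa [setIntegral_const, smul_eq_mul, mul_one, hball R (by linarith)] at h1
  have key2 : ∀ R : ℝ, 1 ≤ R → v₁ * R ≤ C := by
    intro R hR
    have hR0 : 0 < R := by linarith
    have h53 : R ^ (5 / 3 : ℝ) ≤ R ^ (2 : ℝ) := Real.rpow_le_rpow_of_exponent_le hR (by norm_num)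
    rw [Real.rpow_two] at h53
    have hC0 : 0 ≤ C := by
      have := key 1 le_rfl
      simp at this
      linarith
    have h3 : R ^ 3 * v₁ ≤ C * R ^ 2 := (key R hR).trans (mul_le_mul_of_nonneg_left h53 hC0)
    have hR2 : 0 < R ^ 2 := by positivity
    have : v₁ * R * R ^ 2 ≤ C * R ^ 2 := by nlinarith
    exact le_of_mul_le_mul_right this hR2
  have h1 := key2 (max 1 (C / v₁ + 1)) (le_max_left _ _)
  have h2 : v₁ * (C / v₁ + 1) ≤ C := (mul_le_mul_of_nonneg_left (le_max_right _ _) hv₁pos.le).trans h1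
  rw [mul_add, mul_div_cancel₀ _ hv₁pos.ne', mul_one] at h2
  linarith

end Summit.AnomalousDissipation.AnomalousDissipation.Theorems.ConeDesingularisation.Negative

end
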